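import Summits.MatrixMultiplication.MatrixMultiplication.Theses.IsotypicSaturation
import Literature.Computability.AlgebraicComplexity.DegenerationSpectralMonotone

/-!
# Idea `stabilizer-perturbation-twin` (crux `PolytopeSaturation`, stmt-MatrixMultiplication-4417) — Lean support

* `first_lemma` (PROVED): every perturbation `y` of `⟨2,2,2⟩` supported on the positive weight space
  `{a.1 = 0, b.1 = 1}` of the one-parameter subgroup of `Stab(⟨2,2,2⟩)` scaling the index shared by the
  first two legs satisfies `⟨2,2,2⟩ + y ⊵ ⟨2,2,2⟩` (`AlgDegeneratesTo`, order 1: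
  `(diag(ε^{[a.1=0]}) ⊗ diag(ε^{[b.1=1]}) ⊗ 1)(⟨2,2,2⟩ + y) = ε·⟨2,2,2⟩ + ε²·y`).
* `PerturbedPolytopeMaximal y₀` (statement, a COMPUTATION in the shape of `UnitTensorPolytopeMaximal`):
  `Δ(⟨2,2,2⟩ + y₀)` is maximal among formats `≤ 4×4×4` (occurrence language).
* `omegaTwo_of_invariance` (PROVED): `PolytopeInvariance` (piece 1 of the split of `PolytopeSaturation`,
  verbatim) `→ PerturbedPolytopeMaximal y₀ → UnitTensorPolytopeMaximal → MatrixMultiplication` for any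
  positively supported `y₀`; `omegaTwo_of_invariance_yOnes` for the explicit `y₀ = yOnes`.
  I.e. an alternative deciding theorem for route IsotypicSaturation through the WEAKER piece, conditional on
  one finite certificate (tenure planner's call; the strategist does not edit `closes`).
-/

set_option linter.dupNamespace false
noncomputable section
namespace Summit.MatrixMultiplication.MatrixMultiplication.Cruxes.PolytopeSaturation.StabiliserPerturbationTwin
open Literature.Computability.AlgebraicComplexity
open Polynomial

/-- `⟨2,2,2⟩` vanishes off the pattern `a.1 = b.1`. -/
theorem matMulTensor_eq_zero_of_ne {a b c : Fin 2 × Fin 2} (h : a.1 ≠ b.1) :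
    matMulTensor ℂ 2 2 2 a b c = 0 := by
  simp [matMulTensor, h]

/-- FIRST LEMMA of the idea `stabilizer-perturbation-twin`: a perturbation of `⟨2,2,2⟩` supported on the
positive weight space `{a.1 = 0, b.1 = 1}` of the one-parameter subgroup scaling the index shared by the
first two legs degenerates back to `⟨2,2,2⟩` with order `1`:
`(A(ε) ⊗ B(ε) ⊗ 1)(⟨2,2,2⟩ + y) = ε·⟨2,2,2⟩ + ε²·y`, `A = diag(ε^{[a.1=0]})`, `B = diag(ε^{[b.1=1]})`. -/
theorem first_lemma (y : (Fin 2 × Fin 2) → (Fin 2 × Fin 2) → (Fin 2 × Fin 2) → ℂ)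
    (hy : ∀ a b c, y a b c ≠ 0 → a.1 = 0 ∧ b.1 = 1) :
    AlgDegeneratesTo (matMulTensor ℂ 2 2 2 + y) (matMulTensor ℂ 2 2 2) := by
  classical
  refine ⟨1, fun a' a => if a = a' then (if a.1 = 0 then X else 1) else 0,
    fun b' b => if b = b' then (if b.1 = 1 then X else 1) else 0,
    fun c' c => if c = c' then 1 else 0, ?_⟩
  intro a' b' c' j hj
  -- collapse the triple sum to its diagonal term
  rw [Finset.sum_eq_single a' (fun a _ ha => by simp [ha]) (by simp)]
  rw [Finset.sum_eq_single b' (fun b _ hb => by simp [hb]) (by simp)]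
  rw [Finset.sum_eq_single c' (fun c _ hc => by simp [hc]) (by simp)]
  simp only [if_true, mul_one, Pi.add_apply]
  -- the perturbation vanishes off the positive weight space
  have hy0 : ¬ (a'.1 = 0 ∧ b'.1 = 1) → y a' b' c' = 0 := fun h => by
    by_contra hne
    exact h (hy a' b' c' hne)
  have fin2 : ∀ i : Fin 2, i ≠ 0 → i = 1 := by
    intro i hi
    fin_cases i
    · exact absurd rfl hi
    · rfl
  by_cases ha0 : a'.1 = 0 <;> by_cases hb1 : b'.1 = 1
  · -- weight 2: `X * X * C v`, invisible in degrees `≤ 1`; and `x = 0` there (`a.1 = 0 ≠ 1 = b.1`)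
    rw [if_pos ha0, if_pos hb1]
    have hx : matMulTensor ℂ 2 2 2 a' b' c' = 0 :=
      matMulTensor_eq_zero_of_ne (by rw [ha0, hb1]; exact Fin.zero_ne_one)
    rw [hx, zero_add, show (X : ℂ[X]) * X * C (y a' b' c') = C (y a' b' c') * X ^ 2 by ring,
      Polynomial.coeff_C_mul_X_pow]
    have hj2 : j ≠ 2 := by omega
    rw [if_neg hj2]
    split_ifs <;> rfl
  · -- weight 1 from `A`: `X * C x`
    have hb0 : b'.1 = 0 := by
      by_contra h
      exact hb1 (fin2 _ h)
    rw [if_pos ha0, if_neg hb1, hy0 (fun h => hb1 h.2), add_zero, mul_one,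
      show (X : ℂ[X]) * C (matMulTensor ℂ 2 2 2 a' b' c') = C (matMulTensor ℂ 2 2 2 a' b' c') * X by ring,
      Polynomial.coeff_C_mul_X]
  · -- weight 1 from `B`: `X * C x`
    rw [if_neg ha0, if_pos hb1, hy0 (fun h => ha0 h.1), add_zero, one_mul,
      show (X : ℂ[X]) * C (matMulTensor ℂ 2 2 2 a' b' c') = C (matMulTensor ℂ 2 2 2 a' b' c') * X by ring,
      Polynomial.coeff_C_mul_X]
  · -- weight 0: `C v` with `v = 0` (`a.1 = 1 ≠ 0 = b.1`, and `y = 0`)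
    have ha1 : a'.1 = 1 := fin2 _ ha0
    have hb0 : b'.1 = 0 := by
      by_contra h
      exact hb1 (fin2 _ h)
    have hx : matMulTensor ℂ 2 2 2 a' b' c' = 0 :=
      matMulTensor_eq_zero_of_ne (by rw [ha1, hb0]; exact Fin.zero_ne_one.symm)
    rw [if_neg ha0, if_neg hb1, hy0 (fun h => ha0 h.1), hx, add_zero, one_mul, map_zero, mul_zero,
      Polynomial.coeff_zero]
    split_ifs <;> rfl


/-- The ONE computation the idea asks for, in the occurrence language of the route (shape of
`UnitTensorPolytopeMaximal` with `⟨4⟩` replaced by `⟨2,2,2⟩ + y₀`): the moment polytope of `⟨2,2,2⟩ + y₀` is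
maximal among tensors of format `≤ 4 × 4 × 4`. -/
def PerturbedPolytopeMaximal (y₀ : (Fin 2 × Fin 2) → (Fin 2 × Fin 2) → (Fin 2 × Fin 2) → ℂ) : Prop :=
  ∀ {ι κ μ : Type} [Fintype ι] [Fintype κ] [Fintype μ], Fintype.card ι ≤ 4 → Fintype.card κ ≤ 4 →
    Fintype.card μ ≤ 4 → ∀ (s : ι → κ → μ → ℂ) (n : ℕ) (lam : Fin 3 → Nat.Partition n), 0 < n →
      isotypicSum₁ (lam 0) (isotypicSum₂ (lam 1) (isotypicSum₃ (lam 2) (kroneckerPow s n))) ≠ 0 →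
      ∃ (k : ℕ) (mu : Fin 3 → Nat.Partition (k * n)), 0 < k ∧
        (∀ j, (mu j).parts = (lam j).parts.map (fun p => k * p)) ∧
        isotypicSum₁ (mu 0) (isotypicSum₂ (mu 1) (isotypicSum₃ (mu 2)
          (kroneckerPow (matMulTensor ℂ 2 2 2 + y₀) (k * n)))) ≠ 0

/-- **ω = 2 from the WEAKER piece.** `PolytopeInvariance` (piece 1 of the split, verbatim as hypothesis
`h₁`) + the route's `UnitTensorPolytopeMaximal` + the one certificate `PerturbedPolytopeMaximal y₀` for a
stabiliser-positive `y₀` give the summit: `F ⟨2,2,2⟩ ≤ F (⟨2,2,2⟩ + y₀)` (degeneration, `first_lemma` and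
`IsUniversalSpectralPoint.mono_of_algDegeneratesTo`) `= F ⟨4⟩` (invariance on the maximal-polytope fibre)
`= 4`, then Strassen duality and `2^ω ≤ R̃(⟨2,2,2⟩)` exactly as in the route's `closes` (steps 3–5 copied). -/
theorem omegaTwo_of_invariance
    (h₁ : ∀ F : Literature.Computability.AlgebraicComplexity.SpectralMap ℂ, Literature.Computability.AlgebraicComplexity.IsUniversalSpectralPoint ℂ F → ∀ {ι κ μ ι' κ' μ' : Type} [Fintype ι] [Fintype κ] [Fintype μ] [Fintype ι'] [Fintype κ'] [Fintype μ'] (s : ι → κ → μ → ℂ) (t : ι' → κ' → μ' → ℂ), (∀ (n : ℕ) (lam : Fin 3 → Nat.Partition n), 0 < n → Literature.Computability.AlgebraicComplexity.isotypicSum₁ (lam 0) (Literature.Computability.AlgebraicComplexity.isotypicSum₂ (lam 1) (Literature.Computability.AlgebraicComplexity.isotypicSum₃ (lam 2) (Literature.Computability.AlgebraicComplexity.kroneckerPow s n))) ≠ 0 → ∃ (k : ℕ) (mu : Fin 3 → Nat.Partition (k * n)), 0 < k ∧ (∀ j, (mu j).parts = (lam j).parts.map (fun p => k * p)) ∧ Literature.Computability.AlgebraicComplexity.isotypicSum₁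 (mu 0) (Literature.Computability.AlgebraicComplexity.isotypicSum₂ (mu 1) (Literature.Computability.AlgebraicComplexity.isotypicSum₃ (mu 2) (Literature.Computability.AlgebraicComplexity.kroneckerPow t (k * n)))) ≠ 0) → (∀ (n : ℕ) (lam : Fin 3 → Nat.Partition n), 0 < n → Literature.Computability.AlgebraicComplexity.isotypicSum₁ (lam 0) (Literature.Computability.AlgebraicComplexity.isotypicSum₂ (lam 1) (Literature.Computability.AlgebraicComplexity.isotypicSum₃ (lam 2) (Literature.Computability.AlgebraicComplexity.kroneckerPow t n))) ≠ 0 → ∃ (k : ℕ) (mu : Fin 3 → Nat.Partition (k * n)), 0 < k ∧ (∀ j, (mu j).parts = (lam j).parts.map (fun p => k * p)) ∧ Literature.Computability.AlgebraicComplexity.isotypicSum₁ (mu 0) (Literature.Computability.AlgebraicComplexity.isotypicSum₂ (mu 1) (Literature.Computability.AlgebraicComplexity.isotypicSum₃ (mu 2) (Literature.Computability.AlgebraicComplexity.kroneckerPow s (k * n)))) ≠ 0) → F s = F t)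
    (y₀ : (Fin 2 × Fin 2) → (Fin 2 × Fin 2) → (Fin 2 × Fin 2) → ℂ)
    (hy : ∀ a b c, y₀ a b c ≠ 0 → a.1 = 0 ∧ b.1 = 1) (hP : PerturbedPolytopeMaximal y₀)
    (hU : Summit.MatrixMultiplication.MatrixMultiplication.Theses.IsotypicSaturation.UnitTensorPolytopeMaximal) :
    _root_.MatrixMultiplication := by
  classical
  have h4 : Fintype.card (Fin 2 × Fin 2) ≤ 4 := by simp
  have h4' : Fintype.card (Fin 4) ≤ 4 := by simp
  -- (2') every universal spectral point takes the value `≤ 4` at `⟨2,2,2⟩`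
  have hF4 : ∀ F : Literature.Computability.AlgebraicComplexity.SpectralMap ℂ,
      Literature.Computability.AlgebraicComplexity.IsUniversalSpectralPoint ℂ F →
        F (Literature.Computability.AlgebraicComplexity.matMulTensor ℂ 2 2 2) ≤ 4 := by
    intro F hF
    -- degeneration `⟨2,2,2⟩ + y₀ ⊵ ⟨2,2,2⟩`
    have hdeg : F (matMulTensor ℂ 2 2 2) ≤ F (matMulTensor ℂ 2 2 2 + y₀) :=
      hF.mono_of_algDegeneratesTo (first_lemma y₀ hy)
    -- invariance on the fibre of the maximal polytope: `F (⟨2,2,2⟩ + y₀) = F ⟨4⟩`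
    have hinv : F (matMulTensor ℂ 2 2 2 + y₀) = F (unitTensor ℂ 4) :=
      h₁ F hF (matMulTensor ℂ 2 2 2 + y₀) (unitTensor ℂ 4)
        (fun n lam hn h => hU h4 h4 h4 (matMulTensor ℂ 2 2 2 + y₀) n lam hn h)
        (fun n lam hn h => hP h4' h4' h4' (unitTensor ℂ 4) n lam hn h)
    -- `F ⟨4⟩ = 4`
    have h2 : F (Literature.Computability.AlgebraicComplexity.unitTensor ℂ 4) = 4 := by
      have e := Literature.Computability.AlgebraicComplexity.TensorClass.evalRingHom_mk hF
        (Literature.Computability.AlgebraicComplexity.unitTensor ℂ 4)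
      rw [← Literature.Computability.AlgebraicComplexity.TensorClass.natCast_eq_mk, map_natCast] at e
      exact_mod_cast e.symm
    exact hdeg.trans (hinv.trans h2).le
  -- (3) Strassen duality (proved in tree): `R̃(⟨2,2,2⟩) ≤ 4`
  have hR : Literature.Computability.AlgebraicComplexity.asymptoticRank
      (Literature.Computability.AlgebraicComplexity.matMulTensor ℂ 2 2 2) ≤ 4 :=
    Literature.Computability.AlgebraicComplexity.strassen_duality_asymptoticRank.asymptoticRank_le
      (Literature.Computability.AlgebraicComplexity.strassen_duality_asymptoticRank_holds ℂ) _ hF4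
  -- (4) `2^ω ≤ R̃(⟨2,2,2⟩)`: termwise, `(2^M)^ω ≤ R(⟨2^M,2^M,2^M⟩) ≤ R(⟨2,2,2⟩^{⊗M})`
  have hpow : (2 : ℝ) ^ Literature.Computability.AlgebraicComplexity.omega ℂ ≤
      Literature.Computability.AlgebraicComplexity.asymptoticRank
        (Literature.Computability.AlgebraicComplexity.matMulTensor ℂ 2 2 2) := by
    unfold Literature.Computability.AlgebraicComplexity.asymptoticRank
    refine le_ciInf fun N => ?_
    -- relabelling `⟨2,2,2⟩^{⊗M} ≅ ⟨2^M,2^M,2^M⟩`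
    have key : Literature.Computability.AlgebraicComplexity.matMulTensor ℂ
        (2 ^ (N + 1)) (2 ^ (N + 1)) (2 ^ (N + 1)) = fun a b c =>
        Literature.Computability.AlgebraicComplexity.kroneckerPow
          (Literature.Computability.AlgebraicComplexity.matMulTensor ℂ 2 2 2) (N + 1)
          (fun i => ((finFunctionFinEquiv.symm a.1) i, (finFunctionFinEquiv.symm a.2) i))
          (fun i => ((finFunctionFinEquiv.symm b.1) i, (finFunctionFinEquiv.symm b.2) i))
          (fun i => ((finFunctionFinEquiv.symm c.1) i, (finFunctionFinEquiv.symm c.2) i)) := by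
      funext a b c
      simp only [Literature.Computability.AlgebraicComplexity.kroneckerPow_apply,
        Literature.Computability.AlgebraicComplexity.matMulTensor]
      by_cases h : a.1 = b.1 ∧ b.2 = c.1 ∧ a.2 = c.2
      · rw [if_pos h]
        obtain ⟨h1, h2, h3⟩ := h
        symm
        refine Finset.prod_eq_one fun i _ => ?_
        rw [if_pos ⟨by rw [h1], by rw [h2], by rw [h3]⟩]
      · rw [if_neg h]
        symm
        have hex : ∃ i, ¬ ((finFunctionFinEquiv.symm a.1) i = (finFunctionFinEquiv.symm b.1) i ∧
            (finFunctionFinEquiv.symm b.2) i = (finFunctionFinEquiv.symm c.1) i ∧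
            (finFunctionFinEquiv.symm a.2) i = (finFunctionFinEquiv.symm c.2) i) := by
          by_contra hall
          push Not at hall
          refine h ⟨?_, ?_, ?_⟩
          · exact finFunctionFinEquiv.symm.injective (funext fun i => (hall i).1)
          · exact finFunctionFinEquiv.symm.injective (funext fun i => (hall i).2.1)
          · exact finFunctionFinEquiv.symm.injective (funext fun i => (hall i).2.2)
        obtain ⟨i, hi⟩ := hex
        exact Finset.prod_eq_zero (Finset.mem_univ i) (if_neg hi)
    have hrel : Literature.Computability.AlgebraicComplexity.tensorRank
        (Literature.Computability.AlgebraicComplexity.matMulTensor ℂ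
          (2 ^ (N + 1)) (2 ^ (N + 1)) (2 ^ (N + 1))) ≤
        Literature.Computability.AlgebraicComplexity.tensorRank
          (Literature.Computability.AlgebraicComplexity.kroneckerPow
            (Literature.Computability.AlgebraicComplexity.matMulTensor ℂ 2 2 2) (N + 1)) := by
      rw [key]
      exact (Literature.Computability.AlgebraicComplexity.tensorRestrictsTo_precomp _ _ _ _).tensorRank_le
    have hn : 2 ≤ 2 ^ (N + 1) := Nat.le_self_pow (Nat.succ_ne_zero N) 2
    have hω := Literature.Computability.AlgebraicComplexity.rpow_omega_le_tensorRank_matMulTensor ℂ hn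
    have hle : (((2 ^ (N + 1) : ℕ)) : ℝ) ^ Literature.Computability.AlgebraicComplexity.omega ℂ ≤
        (Literature.Computability.AlgebraicComplexity.tensorRank
          (Literature.Computability.AlgebraicComplexity.kroneckerPow
            (Literature.Computability.AlgebraicComplexity.matMulTensor ℂ 2 2 2) (N + 1)) : ℝ) :=
      hω.trans (by exact_mod_cast hrel)
    have hz : (0 : ℝ) ≤ ((N : ℝ) + 1)⁻¹ := by positivity
    have hmono := Real.rpow_le_rpow (by positivity) hle hz
    refine le_trans (le_of_eq ?_) hmono
    push_cast
    rw [← Real.rpow_natCast, ← Real.rpow_mul (by norm_num : (0 : ℝ) ≤ 2),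
      ← Real.rpow_mul (by norm_num : (0 : ℝ) ≤ 2)]
    congr 1
    push_cast
    field_simp
  -- (5) `2^ω ≤ 4 = 2^2`, so `ω ≤ 2`; with `2 ≤ ω` (flattening, proved in tree) `ω = 2`
  have h22 : (2 : ℝ) ^ Literature.Computability.AlgebraicComplexity.omega ℂ ≤ (2 : ℝ) ^ (2 : ℝ) := by
    calc (2 : ℝ) ^ Literature.Computability.AlgebraicComplexity.omega ℂ
        ≤ Literature.Computability.AlgebraicComplexity.asymptoticRank
            (Literature.Computability.AlgebraicComplexity.matMulTensor ℂ 2 2 2) := hpow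
      _ ≤ 4 := hR
      _ = (2 : ℝ) ^ (2 : ℝ) := by norm_num
  have hω2 : Literature.Computability.AlgebraicComplexity.omega ℂ ≤ 2 :=
    (Real.rpow_le_rpow_left_iff (by norm_num : (1 : ℝ) < 2)).1 h22
  show Literature.Computability.AlgebraicComplexity.omega ℂ = 2
  exact le_antisymm hω2 (Literature.Computability.AlgebraicComplexity.omega_two_le ℂ)

/-- The explicit rational candidate: `y₀ = 𝟙` on the positive weight space `{a.1 = 0, b.1 = 1}` (16 entries).
Numerics (kit j022199/j022219/j022237 and `y0explicit`): both printed Kron(4,4,4)-separators of `Δ(⟨2,2,2⟩)`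
(the `p₄ = (u₂|u₃|u₄)` family, arXiv:2503.22633 Thm 1.4, and the vertex `((½,⅙,⅙,⅙)|(½,½)|u₄)` family cut
off by the inequality `h` of arXiv:2510.08336 §6.4) ENTER `Δ(⟨2,2,2⟩ + yOnes)`. -/
def yOnes : (Fin 2 × Fin 2) → (Fin 2 × Fin 2) → (Fin 2 × Fin 2) → ℂ :=
  fun a b _ => if a.1 = 0 ∧ b.1 = 1 then 1 else 0

/-- `yOnes` is supported on the positive weight space. -/
theorem yOnes_support : ∀ a b c, yOnes a b c ≠ 0 → a.1 = 0 ∧ b.1 = 1 := by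
  intro a b c h
  by_contra hn
  exact h (by simp [yOnes, hn])

/-- **ω = 2 ⟸ PolytopeInvariance ∧ PerturbedPolytopeMaximal yOnes ∧ UnitTensorPolytopeMaximal** — the
summit from the weaker piece plus ONE moment-polytope certificate for the explicit tensor `⟨2,2,2⟩ + yOnes`. -/
theorem omegaTwo_of_invariance_yOnes
    (h₁ : ∀ F : Literature.Computability.AlgebraicComplexity.SpectralMap ℂ, Literature.Computability.AlgebraicComplexity.IsUniversalSpectralPoint ℂ F → ∀ {ι κ μ ι' κ' μ' : Type} [Fintype ι] [Fintype κ] [Fintype μ] [Fintype ι'] [Fintype κ'] [Fintype μ'] (s : ι → κ → μ → ℂ) (t : ι' → κ' → μ' → ℂ), (∀ (n : ℕ) (lam : Fin 3 → Nat.Partition n), 0 < n → Literature.Computability.AlgebraicComplexity.isotypicSum₁ (lam 0) (Literature.Computability.AlgebraicComplexity.isotypicSum₂ (lam 1) (Literature.Computability.AlgebraicComplexity.isotypicSum₃ (lam 2) (Literature.Computability.AlgebraicComplexity.kroneckerPow s n))) ≠ 0 → ∃ (k : ℕ) (mu : Fin 3 → Nat.Partition (k * n)), 0 < k ∧ (∀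 j, (mu j).parts = (lam j).parts.map (fun p => k * p)) ∧ Literature.Computability.AlgebraicComplexity.isotypicSum₁ (mu 0) (Literature.Computability.AlgebraicComplexity.isotypicSum₂ (mu 1) (Literature.Computability.AlgebraicComplexity.isotypicSum₃ (mu 2) (Literature.Computability.AlgebraicComplexity.kroneckerPow t (k * n)))) ≠ 0) → (∀ (n : ℕ) (lam : Fin 3 → Nat.Partition n), 0 < n → Literature.Computability.AlgebraicComplexity.isotypicSum₁ (lam 0) (Literature.Computability.AlgebraicComplexity.isotypicSum₂ (lam 1) (Literature.Computability.AlgebraicComplexity.isotypicSum₃ (lam 2) (Literature.Computability.AlgebraicComplexity.kroneckerPow t n))) ≠ 0 → ∃ (k : ℕ) (mu : Fin 3 → Nat.Partition (k * n)), 0 < k ∧ (∀ j, (mu j).parts = (lam j).parts.map (fun p => k * p)) ∧ Literature.Computability.AlgebraicComplexity.isotypicSum₁ (mu 0) (Literature.Computability.AlgebraicComplexity.isotypicSum₂ (mu 1) (Literature.Computability.AlgebraicComplexity.isotypicSum₃ (mu 2) (Literature.Computability.AlgebraicComplexity.kroneckerPow s (k * n)))) ≠ 0) → F s = F t)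
    (hP : PerturbedPolytopeMaximal yOnes)
    (hU : Summit.MatrixMultiplication.MatrixMultiplication.Theses.IsotypicSaturation.UnitTensorPolytopeMaximal) :
    _root_.MatrixMultiplication :=
  omegaTwo_of_invariance h₁ yOnes yOnes_support hP hU

end Summit.MatrixMultiplication.MatrixMultiplication.Cruxes.PolytopeSaturation.StabiliserPerturbationTwin
end
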